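import Literature.AnabelianGeometry.AbsoluteAnabelian.AbsTopII.EllipticCuspidalization
import Literature.AnabelianGeometry.AbsoluteAnabelian.MLFGaloisElasticProofs
import Literature.AnabelianGeometry.SemiGraphs.ProSigmaCompletionTFG
import HarnessLib

/-!
# [AbsTopII] Remark 3.3.2 («`Δ ⊆ Π` is group-theoretic») for MLF base and `Δ` pro-`Σ`, `Σ ≠ Primes` —
# UNCONDITIONAL via [AbsTopI] Thm 2.6 (iv)

S. Mochizuki, *Topics in Absolute Anabelian Geometry II* (2013) [AbsTopII], Remark 3.3.2 p. 69: the
reconstruction algorithms of Cor 3.3 may be applied "to the single profinite group `Π`", because "the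
subgroup `Δ ⊆ Π` admits a purely group-theoretic characterization [cf. [AbsTopI], Theorem 2.6 (v), (vi)]"
— typed by abc-iut-L4-t6 as `AbsTopII.Rmk_3_3_2 𝒦` (every `Π_E ⥲ Π_F` between members of the class `𝒦`
carries `Δ_E` onto `Δ_F`).  The tree proves it for NF base (`rmk_3_3_2_NF_holds`, via [AbsAnab] Thm 1.1.2)
and for MLF base in the case `Σ = Primes` relative to [AbsTopI] Thm 2.6 (v)
(`rmk_3_3_2_MLF_of_coinvariantRankConstant` / `_of_starCondition`).

THIS PROOF-ONLY FILE adds the MLF case `Σ ≠ Primes` ([AbsTopI] Thm 2.6 (iv): "if `Σ ≠ Primes`, the kernel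
of `Π ↠ G` may be characterized as the maximal almost pro-omissive topologically finitely generated
closed normal subgroup") — UNCONDITIONAL, by `FundamentalExtension.MLFBase.preservesGeom` (whose
elasticity input [AbsTopI] Thm 1.7 (ii) is the cell's theorem `isElastic_absoluteGaloisGroup`):

* `AbsTopII.rmk_3_3_2_MLF_of_isProSet` — on `{E | MLF base, Δ tfg, Δ pro-Σ for some Σ ⊊ Primes}`;
* `AbsTopII.rmk_3_3_2_MLF_puncturedSurfaceModel` — on the MODEL class «`Δ_E` a pro-`Σ` completion of a
  punctured surface group `Γ_{g,r}`, `Σ ⊊ Primes`» (Prop 2.2 at the model supplies "`Δ` tfg").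

HONEST SCOPE: the case of [IUTchI–III] is `Σ = Primes` (Thm 2.6 (v) route, not this file).  Classical;
nothing here bears on [IUTchIII] Cor. 3.12; no side is taken.
-/

noncomputable section

namespace Literature.AnabelianGeometry.AbsoluteAnabelian

namespace AbsTopII

open FundamentalExtension
open Literature.AnabelianGeometry.SemiGraphs.SemiGraphOfAnabelioids
open Literature.GroupTheory.CombinatorialGroupTheory

/-- **[AbsTopII] Remark 3.3.2, `k` an MLF, `Δ` pro-`Σ` with `Σ ≠ Primes` — UNCONDITIONAL.**  On the class
of extensions `1 → Δ → Π → G → 1` with MLF base data `G ≅ G_k`, `Δ` topologically finitely generated and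
pro-`Σ` for some set of primes `Σ ≠ Primes`, every isomorphism of topological groups `Π_E ⥲ Π_F` carries
`Δ_E` onto `Δ_F` ([AbsTopI] Thm 2.6 (iv), via `MLFBase.preservesGeom`).
[cite: MochizukiAbsTopII2013, Rmk 3.3.2 p.69] [cite: MochizukiAbsTopI2012, Thm 2.6 (iv) p.22] -/
theorem rmk_3_3_2_MLF_of_isProSet :
    Rmk_3_3_2 {E : FundamentalExtension.{0} | ∃ _B : E.MLFBase, E.GeomTFG ∧
      ∃ S : Set ℕ, S ⊆ {q | q.Prime} ∧ S ≠ {q | q.Prime} ∧ IsProSet E.geom S} := by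
  intro E hE F hF φ
  obtain ⟨BE, hΔE, S, hS, hS', hES⟩ := hE
  obtain ⟨BF, hΔF, T, hT, hT', hFT⟩ := hF
  exact MLFBase.preservesGeom BE BF hΔE hΔF hS hS' hES hT hT' hFT φ

/-- Monotonicity form: Remark 3.3.2 on any subclass. [cite: MochizukiAbsTopII2013, Rmk 3.3.2 p.69] -/
theorem rmk_3_3_2_mono_MLF_of_isProSet {𝒦 : Set FundamentalExtension.{0}}
    (h𝒦 : 𝒦 ⊆ {E : FundamentalExtension.{0} | ∃ _B : E.MLFBase, E.GeomTFG ∧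
      ∃ S : Set ℕ, S ⊆ {q | q.Prime} ∧ S ≠ {q | q.Prime} ∧ IsProSet E.geom S}) : Rmk_3_3_2 𝒦 :=
  rmk_3_3_2_MLF_of_isProSet.mono h𝒦

/-- **[AbsTopII] Remark 3.3.2 at the surface-group MODEL class, MLF base, `Σ ≠ Primes`**: on the class of
extensions with MLF base data whose `Δ` carries a pro-`Σ` completion structure `ι : Γ_{g,r} → Δ` of a
punctured surface group (any `(g, r)`), `Σ ⊊ Primes`, every `Π_E ⥲ Π_F` carries `Δ_E` onto `Δ_F` —
"`Δ` tfg" by [AbsTopI] Prop 2.2 at the model (`geomTFG_of_isProSigmaCompletion_puncturedSurfaceGroup`),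
"`Δ` pro-`Σ`" by the completion structure.
[cite: MochizukiAbsTopII2013, Rmk 3.3.2 p.69] [cite: MochizukiAbsTopI2012, Thm 2.6 (iv) p.22] -/
theorem rmk_3_3_2_MLF_puncturedSurfaceModel :
    Rmk_3_3_2 {E : FundamentalExtension.{0} | ∃ (_B : E.MLFBase) (g r : ℕ) (S : Set ℕ)
      (ι : PuncturedSurfaceGroup g r →* E.geom),
        S ⊆ {q | q.Prime} ∧ S ≠ {q | q.Prime} ∧ IsProSigmaCompletion S ι} := by
  refine rmk_3_3_2_MLF_of_isProSet.mono ?_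
  rintro E ⟨B, g, r, S, ι, hS, hS', hι⟩
  exact ⟨B, E.geomTFG_of_isProSigmaCompletion_puncturedSurfaceGroup ι hι, S, hS, hS',
    ⟨fun U hUn hUo q hq hdvd => (hι.index_open U hUn hUo).2 q hq hdvd⟩⟩

end AbsTopII

end Literature.AnabelianGeometry.AbsoluteAnabelian

end
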